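import Summits.BirchSwinnertonDyer.Rank1Residual.P2.CongruentNumberPairsAtTwoGenusPointData
import Summits.BirchSwinnertonDyer.Rank1Residual.P2.CongruentNumberCor515SelmerEight
import Summits.BirchSwinnertonDyer.Rank1Residual.P2.TianFamilySevenAtTwo
import Literature.NumberTheory.EllipticCurves.CongruentNumberEvenMonskySelmerExact
import Literature.NumberTheory.EllipticCurves.CongruentNumberOddMonskySelmerExact
import Literature.NumberTheory.QuadraticFields.RedeiReichardtFourRank
import HarnessLib

/-!
# Cell `bsd-print-cf2` (leaf CornerF @ `p = 2`, row B14), prover p2 — the `2`-DESCENT-MATRIX ROAD, file 2/2: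
# the uniform rank-one FAMILIES `q₇`, `p₃q₅`, `p₃q₇` of `B14 ∩ {j = 1728}` ON KERNEL `2`-DESCENT
# (Monsky's `#Sel₂(E_D) = 2^{2+s(D)}` and Rédei–Reichardt are TREE THEOREMS; Monsky 1990 Cor 5.15 is
# replaced by the kernel Selmer count + Gross–Zagier–Kolyvagin) — displayed set `{TYZ, GZK}` and nothing else

HONEST FRAMING (cell `bsd-print-cf2`, HOME `run/shared/lean/pub/bsd-print-cf2/`; D-0131 (2) PRINT TIER;
PARTITION currency, D-0054 (2)). The leaf is `CornerF W 2 = HasCM ∧ analyticRank = 1` at `p = 2` (row B14 /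
O12 of `pub/pub-bsdres/PARTITION-SCOREBOARD.md`; `0` census cells, OPEN AS A CLASS). This file is about ONE
companion family inside it — the congruent-number curves `E_n : y² = x³ − n²x` (CM by `ℤ[i]`, `2` ramified)
of analytic rank one — and it asserts NO arithmetic fact: every theorem is a kernel theorem MODULO the named
journal facts in its binders, which after this file are EXACTLY
* `hTYZ : tyz_genusPointData` — Tian–Yuan–Zhang, Asian J. Math. 21 (2017) §3 (Prop. 3.4, Thm. 3.5,
  Lemmas 3.18/3.21), displayed sentence by sentence (`TianYuanZhang2017/GenusPointDescentDisplays.lean`), or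
  `h12 : thm12_parity_of_scriptL'` — ibid. Thm. 1.2 AS PRINTED (`GenusPeriodsParity.lean`, ERRATUM F-Σ2 form);
* `hGZK : rank_eq_analyticRank_of_analyticRank_le_one` — Gross–Zagier–Kolyvagin (`LeadingTerm.lean`).
"Beyond-print theorem": NO — the `2`-part of BSD for these families is asserted in print (Tian, Proc. ICM
2022, Thm. 8 / p. 1993, for the Tian–Yuan–Zhang/Smith families) and was already LITERAL-by-name in the tree;
what changes is the DISPLAYED SET. The doors landed by the sub-lane «bsd-p2» (2026-08-21…24) displayed, besides
`hTYZ`/`h12` and `hGZK`, up to three further named facts per door: Monsky's `2`-descent matrix theorem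
`hM : HeathBrown1994.monsky_card_selmerGroup_two_odd` / `hMe : …_even` (appendix to Heath-Brown 1994 —
flag `HB94-even-sketch` on the even side), the Rédei–Reichardt four-rank theorem
`hR : redeiReichardt_fourTwoCard_classGroup`, and Monsky 1990 Cor. 5.15 with Remark (2)
`h515 : Monsky1990.cor515_rank_eq_one_and_card_selmerGroup_two` (flags A301). Since then the tree PROVED
`hM`/`hMe` (`HeathBrown1994.monsky_card_selmerGroup_two_odd_holds` / `…_even_holds`, cell `bsd-monsky`
prover-B g15, p500655…p510805), `hR` (`RedeiReichardt.redeiReichardt_fourTwoCard_classGroup_holds`) and the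
Selmer clause of `h515` (`P2.card_selmerGroup_two_eq_eight_of_isCor515Family`, prover-A g11, p528474); the
rank clause of `h515` is supplied by `hTYZ`/`h12` (`ord_{s=1} L(E_n, s) = 1`) and `hGZK` (rank `1`). This
file (2/2; the general doors and the `ω = 3` atlas are file 1/2, `CongruentNumberGenusDoorsKernelDescent.lean`)
performs the substitution for the three UNIFORM FAMILIES with no per-member input, proving for each member
`ord_{s=1} L(E_n, s) = 1`, rank `1`, `Ш(E_n)[2^∞] = 0` and `BSD(E_n, 2)`:
* every prime `q ≡ 7 (mod 8)` — modulo `{h12, hGZK}` (was `{h12, hR, h515}`);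
* every `n = p·q`, `p ≡ 3`, `q ≡ 5 (mod 8)` — modulo `{h12, hGZK}` (was `{h12, hR, h515}`);
* every `n = p·q`, `p ≡ 3`, `q ≡ 7 (mod 8)` — modulo `{hTYZ, hGZK}` (was `{hTYZ, hGZK, hR, h515}`);
and (§2) for TIAN'S 2014 FAMILIES, uniformly in the number `k + 1` of odd prime factors (`p₀` free,
`pᵢ ≡ 1 (mod 8)` for `i ≥ 1`, odd Legendre graph `hG`):
* class `7` (`p₀ ≡ 7 (mod 8)`, `n = p₀⋯p_k`) — modulo `{h12, hGZK}` (route A was `{h12, hR, hGZK, hM}`,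
  route B `{h12, h13, hR}` with `h13` = Tian 2014 Thm 1.3);
* class `6` (`p₀ ≡ 3 (mod 4)`, `n = 2p₀⋯p_k`) — modulo `{hTYZ, hGZK}` (was `{hTYZ, hGZK, h13, hR}`): Tian's
  Thm 1.3 is no longer displayed — its `2`-descent content (Lemma 5.3: `s = 1`) is the tree's
  `card_ker_monskyMatrixEven_caseSix` + Monsky's even formula with equality.
Nothing here moves a census number (`0` cells in B14); nothing is booked by this file; no mark moved. What it
gives the cell's referee: on these sub-families of the leaf the by-name closure of `BSD(E, 2)` rests on ONE
displayed paper (TYZ 2017, refereed) plus GZK, with the `2`-descent side — `#Sel₂`, `Ш[2]`, `ρ`, genus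
parities via Rédei matrices — decided in the kernel. Unit `bsd-print-cf2-p2` g0; NEW file.

References: [TianYuanZhang2017] Thm 1.2, §3 (Prop 3.4, Thm 3.5); [HeathBrown1994SelmerCongruentII] Appendix
(Monsky) typescript pp. 39–41; [Monsky1990MockHeegner] Cor 5.15, Remark (2); [FaulknerJames2007] Thm 1.2 (2);
[Miller2011LMS] Def 1.1; [Tian2023CongruentICM] Thm 8, p. 1993.
-/

noncomputable section

open scoped Classical

open Matrix Finset WeierstrassCurve NumberField Literature.NumberTheory.EllipticCurves
  Literature.NumberTheory.EllipticCurves.Rank1Residual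
  Literature.NumberTheory.EllipticCurves.Rank1Residual.Typed
  Literature.NumberTheory.EllipticCurves.Monsky1990
  Literature.NumberTheory.EllipticCurves.HeathBrown1994
  Literature.NumberTheory.EllipticCurves.HeathBrown1994.Families
  Literature.NumberTheory.EllipticCurves.TianYuanZhang2017
  Literature.NumberTheory.EllipticCurves.Tian2014
  Literature.NumberTheory.EllipticCurves.FaulknerJames2007
  Literature.NumberTheory.QuadraticFields.RedeiReichardt

set_option autoImplicit false

namespace Summit.BirchSwinnertonDyer.Rank1Residual.P2

/-! ## §1 The uniform prime and two-prime families, on kernel descent -/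

section Families

/-- **THE PRIME FAMILY `q ≡ 7 (mod 8)`, ON KERNEL DESCENT.** For every prime `q ≡ 7 (mod 8)`
(`E_q : y² = x³ − q²x`, root number `−1`): `ord_{s=1} L(E_q, s) = 1`, rank `1`, `Ш(E_q)[2^∞] = 0` and
`BSD(E_q, 2)` — modulo `h12` (TYZ Thm 1.2 AS PRINTED) and `hGZK` ONLY. The `2`-descent inputs are tree
theorems: `ρ(q) = 0` (Faulkner–James, `rhoIndex_eq_one_of_prime`), `Σ₁(q) = g(q)` odd
(Rédei–Reichardt `_holds` at `t = 1`), `#Sel₂(E_q) = 8` (Monsky's one-prime table, kernel), torsion `4`,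
Tamagawa product `8`. (Previously displayed: `hR`, `h515`.)
[cite: TianYuanZhang2017, Thm. 1.2 and §1 (1.1); proof of Prop. 3.4 (p0016 L146)]
[cite: Monsky1990MockHeegner, Cor. 5.15 (1) (p. 66), Remark (2) (p. 67)] [cite: FaulknerJames2007, Thm. 1.2 (2)]
[cite: Miller2011LMS, Def. 1.1 (arXiv:1010.2431 p. 3)] -/
theorem rankOne_sha_bsdp_two_congruentNumberCurve_prime_seven_mod_eight_descent
    (h12 : thm12_parity_of_scriptL') (hGZK : rank_eq_analyticRank_of_analyticRank_le_one)
    {q : ℕ} (hq : q.Prime) (h8 : q % 8 = 7) :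
    haveI := isElliptic_congruentNumberCurve hq.ne_zero
    (congruentNumberCurve q).analyticRank = 1 ∧ (congruentNumberCurve q).mordellWeilRank = 1 ∧
      AddCommGroup.primaryComponent (congruentNumberCurve q).sha 2 = ⊥ ∧
      BSDp (congruentNumberCurve q) 2 := by
  haveI := isElliptic_congruentNumberCurve hq.ne_zero
  haveI : Fact (Nat.Prime 2) := ⟨Nat.prime_two⟩
  have hsq : Squarefree q := hq.squarefree
  have hqodd : Odd q := Nat.odd_iff.mpr (by omega)
  have hN : IsCor515Family q := Or.inl ⟨hq, Or.inr h8⟩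
  have hρ : (rhoSubgroup q).index = 1 := rhoIndex_eq_one_of_prime hq (Or.inr h8)
  -- TYZ Thm 1.2 at `ρ = 0`, `Σ₁(q) = g(q)` odd: `ord = 1`, `L′ = 2^e · 𝓛² · Ω · Reg` with `𝓛` odd
  obtain ⟨Lz, hLodd, hr1, hderiv⟩ := rankOneDatum_of_index_eq_one' h12 hsq (Or.inr h8) hρ GenusField
    (isGenusFieldFamily_genusField q)
    (Or.inl (odd_genusSum₁_genusField_prime redeiReichardt_fourTwoCard_classGroup_holds hq (by omega)))
  have hx : deriv (congruentNumberCurve q).entireLFunction 1 =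
      (((2 : ℚ) ^ twoExponent q * (Lz : ℚ) ^ 2 : ℚ) : ℂ) *
        ((congruentNumberCurve q).realPeriodRat : ℂ) * ((congruentNumberCurve q).regulator : ℂ) := by
    rw [hderiv]; push_cast; ring
  -- GZK: rank `1`; kernel Selmer count `8`; hence `Ш[2^∞] = 0`
  obtain ⟨hrank, -⟩ := hGZK (congruentNumberCurve q) (le_of_eq hr1)
  rw [hr1] at hrank
  have hsel := card_selmerGroup_two_eq_eight_of_isCor515Family hN
  have hbot := primaryComponent_sha_two_eq_bot_of_card_selmerGroup_eq_eight hq.ne_zero hrank hsel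
  refine ⟨hr1, hrank, hbot, ?_⟩
  rw [bsdp_two_iff_of_LDerivOverOmegaReg_of_sha_two_eq_bot_of_torsionOrder_eq_four (congruentNumberCurve q)
    hGZK hr1 hx hbot (torsionOrder_congruentNumberCurve hsq), padicValRat_two_zpow_mul_sq hLodd,
    twoExponent_prime hq hqodd, tamagawaProduct_congruentNumberCurve_of_odd hsq hqodd, hq.primeFactors,
    Finset.card_singleton, padicValNat.prime_pow]
  norm_num

/-- **`BSD(E_q, 2)` for EVERY prime `q ≡ 7 (mod 8)`, ON KERNEL DESCENT** (`∀`-form), modulo `h12`, `hGZK`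
only. [cite: TianYuanZhang2017, Thm. 1.2 and §1 (1.1)] [cite: FaulknerJames2007, Thm. 1.2 (2)]
[cite: Miller2011LMS, Def. 1.1 (arXiv:1010.2431 p. 3)] -/
theorem forall_bsdp_two_congruentNumberCurve_prime_seven_mod_eight_descent
    (h12 : thm12_parity_of_scriptL') (hGZK : rank_eq_analyticRank_of_analyticRank_le_one) :
    ∀ q : ℕ, q.Prime → q % 8 = 7 → BSDp (congruentNumberCurve q) 2 :=
  fun _ hq h8 => (rankOne_sha_bsdp_two_congruentNumberCurve_prime_seven_mod_eight_descent h12 hGZK hq h8).2.2.2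

/-- **THE TWO-PRIME FAMILY `p₃·q₅`, ON KERNEL DESCENT.** For all primes `p ≡ 3`, `q ≡ 5 (mod 8)`
(`n = pq ≡ 7 (mod 8)`): `ord_{s=1} L(E_{pq}, s) = 1`, rank `1`, `Ш(E_{pq})[2^∞] = 0`, `BSD(E_{pq}, 2)` —
modulo `h12`, `hGZK` ONLY. Tree theorems used: `ρ(pq) = 0` (Faulkner–James Laplacian,
`rhoIndex_eq_one_three_five`), `Σ₁` odd or `Σ₂′` odd (Rédei–Reichardt `_holds`), `#Sel₂(E_{pq}) = 8`
(Monsky's matrix at `k = 2`, kernel: Cor. 5.15 family (2)), torsion `4`, Tamagawa `32`. (Previously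
displayed: `hR`, `h515`.) [cite: TianYuanZhang2017, Thm. 1.2 and §1 (1.1); proof of Prop. 3.4 (p0016 L146)]
[cite: Monsky1990MockHeegner, Cor. 5.15 (2) (p. 66), Remark (2) (p. 67)] [cite: FaulknerJames2007, Thm. 1.2 (2)]
[cite: Miller2011LMS, Def. 1.1 (arXiv:1010.2431 p. 3)] -/
theorem rankOne_sha_bsdp_two_congruentNumberCurve_three_five_descent (h12 : thm12_parity_of_scriptL')
    (hGZK : rank_eq_analyticRank_of_analyticRank_le_one)
    {p q : ℕ} (hp : p.Prime) (hq : q.Prime) (hp3 : p % 8 = 3) (hq5 : q % 8 = 5) :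
    haveI := isElliptic_congruentNumberCurve (Nat.mul_ne_zero hp.ne_zero hq.ne_zero)
    (congruentNumberCurve (p * q)).analyticRank = 1 ∧ (congruentNumberCurve (p * q)).mordellWeilRank = 1 ∧
      AddCommGroup.primaryComponent (congruentNumberCurve (p * q)).sha 2 = ⊥ ∧
      BSDp (congruentNumberCurve (p * q)) 2 := by
  have hne : p ≠ q := fun h => by omega
  haveI := isElliptic_congruentNumberCurve (Nat.mul_ne_zero hp.ne_zero hq.ne_zero)
  haveI : Fact (Nat.Prime 2) := ⟨Nat.prime_two⟩
  have hsq : Squarefree (p * q) := by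
    rw [Nat.squarefree_mul ((Nat.coprime_primes hp hq).mpr hne)]
    exact ⟨hp.squarefree, hq.squarefree⟩
  have h8 : (p * q) % 8 = 7 := by rw [Nat.mul_mod, hp3, hq5]
  have hN : IsCor515Family (p * q) := Or.inr (Or.inr (Or.inl ⟨p, q, hp, hq, hp3, Or.inr hq5, rfl⟩))
  have hρ := rhoIndex_eq_one_three_five hp hq hp3 hq5
  obtain ⟨Lz, hLodd, hr1, hderiv⟩ := rankOneDatum_of_index_eq_one' h12 hsq (Or.inr h8) hρ GenusField
    (isGenusFieldFamily_genusField (p * q))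
    (odd_genusSum_genusField_three_five' redeiReichardt_fourTwoCard_classGroup_holds hp hq hp3 hq5)
  have hx : deriv (congruentNumberCurve (p * q)).entireLFunction 1 =
      (((2 : ℚ) ^ twoExponent (p * q) * (Lz : ℚ) ^ 2 : ℚ) : ℂ) *
        ((congruentNumberCurve (p * q)).realPeriodRat : ℂ) *
          ((congruentNumberCurve (p * q)).regulator : ℂ) := by
    rw [hderiv]; push_cast; ring
  have hpv : ∀ i, ((![p, q] : Fin 2 → ℕ) i).Prime := fun i => by fin_cases i <;> assumption
  have hov : ∀ i, Odd ((![p, q] : Fin 2 → ℕ) i) := fun i => by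
    fin_cases i
    · exact hp.odd_of_ne_two (fun h => by omega)
    · exact hq.odd_of_ne_two (fun h => by omega)
  have hiv : Function.Injective (![p, q] : Fin 2 → ℕ) := by
    intro i j h; fin_cases i <;> fin_cases j <;> simp_all [hne.symm]
  have hnv : ∏ i, (![p, q] : Fin 2 → ℕ) i = p * q := by simp [Fin.prod_univ_two]
  have he : twoExponent (p * q) = 1 := by
    rw [← hnv, twoExponent_prod_eq _ hpv hov hiv]; norm_num
  -- GZK: rank `1`; kernel Selmer count `8`; hence `Ш[2^∞] = 0`
  obtain ⟨hrank, -⟩ := hGZK (congruentNumberCurve (p * q)) (le_of_eq hr1)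
  rw [hr1] at hrank
  have hsel := card_selmerGroup_two_eq_eight_of_isCor515Family hN
  have hbot := primaryComponent_sha_two_eq_bot_of_card_selmerGroup_eq_eight
    (Nat.mul_ne_zero hp.ne_zero hq.ne_zero) hrank hsel
  refine ⟨hr1, hrank, hbot, ?_⟩
  rw [bsdp_two_iff_of_LDerivOverOmegaReg_of_sha_two_eq_bot_of_torsionOrder_eq_four
    (congruentNumberCurve (p * q)) hGZK hr1 hx hbot (torsionOrder_congruentNumberCurve hsq),
    padicValRat_two_zpow_mul_sq hLodd, he, tamagawaProduct_congruentNumberCurve_prod _ hpv hov hiv hnv,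
    padicValNat.prime_pow]
  norm_num

/-- **`BSD(E_{pq}, 2)` for ALL primes `p ≡ 3`, `q ≡ 5 (mod 8)`, ON KERNEL DESCENT** (`∀`-form), modulo
`h12`, `hGZK` only. [cite: TianYuanZhang2017, Thm. 1.2 and §1 (1.1)] [cite: FaulknerJames2007, Thm. 1.2 (2)]
[cite: Miller2011LMS, Def. 1.1 (arXiv:1010.2431 p. 3)] -/
theorem forall_bsdp_two_congruentNumberCurve_three_five_descent (h12 : thm12_parity_of_scriptL')
    (hGZK : rank_eq_analyticRank_of_analyticRank_le_one) :
    ∀ p q : ℕ, p.Prime → q.Prime → p % 8 = 3 → q % 8 = 5 → BSDp (congruentNumberCurve (p * q)) 2 :=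
  fun _ _ hp hq hp3 hq5 =>
    (rankOne_sha_bsdp_two_congruentNumberCurve_three_five_descent h12 hGZK hp hq hp3 hq5).2.2.2

/-- **THE TWO-PRIME FAMILY `p₃·q₇`, ON KERNEL DESCENT (ρ-free, via U⁺).** For all primes `p ≡ 3`,
`q ≡ 7 (mod 8)` (`n = pq ≡ 5 (mod 8)`; `ρ(pq) = 1` on every computed member, so no Thm-1.2 route):
`ord_{s=1} L(E_{pq}, s) = 1`, rank `1`, `Ш(E_{pq})[2^∞] = 0`, `BSD(E_{pq}, 2)` — modulo `hTYZ` (TYZ §3, through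
the U⁺ composition) and `hGZK` ONLY. Tree theorems used: `Σ₁` odd or `Σ₂′` odd (`g(p)`, `g(q)` odd by
Rédei–Reichardt `_holds`), `#Sel₂(E_{pq}) = 8` (Monsky's matrix at `k = 2`, kernel: Cor. 5.15 family (2)),
torsion `4`, Tamagawa `32`. (Previously displayed: `hR`, `h515`.)
[cite: TianYuanZhang2017, Thm. 1.2, Thm. 3.5 and §1 (1.1)]
[cite: Monsky1990MockHeegner, Cor. 5.15 (2) (p. 66), Remark (2) (p. 67)]
[cite: Miller2011LMS, Def. 1.1 (arXiv:1010.2431 p. 3)] -/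
theorem rankOne_sha_bsdp_two_congruentNumberCurve_three_seven_descent (hTYZ : tyz_genusPointData)
    (hGZK : rank_eq_analyticRank_of_analyticRank_le_one)
    {p q : ℕ} (hp : p.Prime) (hq : q.Prime) (hp3 : p % 8 = 3) (hq7 : q % 8 = 7) :
    haveI := isElliptic_congruentNumberCurve (Nat.mul_ne_zero hp.ne_zero hq.ne_zero)
    (congruentNumberCurve (p * q)).analyticRank = 1 ∧ (congruentNumberCurve (p * q)).mordellWeilRank = 1 ∧
      AddCommGroup.primaryComponent (congruentNumberCurve (p * q)).sha 2 = ⊥ ∧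
      BSDp (congruentNumberCurve (p * q)) 2 := by
  have hne : p ≠ q := fun h => by omega
  haveI := isElliptic_congruentNumberCurve (Nat.mul_ne_zero hp.ne_zero hq.ne_zero)
  haveI : Fact (Nat.Prime 2) := ⟨Nat.prime_two⟩
  have hsq : Squarefree (p * q) := by
    rw [Nat.squarefree_mul ((Nat.coprime_primes hp hq).mpr hne)]
    exact ⟨hp.squarefree, hq.squarefree⟩
  have h8 : (p * q) % 8 = 5 := by rw [Nat.mul_mod, hp3, hq7]
  have hN : IsCor515Family (p * q) := Or.inr (Or.inr (Or.inl ⟨p, q, hp, hq, hp3, Or.inl hq7, rfl⟩))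
  -- U⁺ (from `hTYZ`, `hGZK`) + the split: `𝓛` odd, `ord = 1`, `L′ = 2^e · 𝓛² · Ω · Reg` — no `ρ`
  obtain ⟨Lz, hLodd, hr1, hderiv⟩ := rankOneDatum_of_uPlus (uPlus_of_genusPointData hTYZ hGZK) hsq
    (Or.inl h8) (odd_genusSum_genusField_three_seven redeiReichardt_fourTwoCard_classGroup_holds hp hq hp3 hq7)
  have hx : deriv (congruentNumberCurve (p * q)).entireLFunction 1 =
      (((2 : ℚ) ^ twoExponent (p * q) * (Lz : ℚ) ^ 2 : ℚ) : ℂ) *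
        ((congruentNumberCurve (p * q)).realPeriodRat : ℂ) *
          ((congruentNumberCurve (p * q)).regulator : ℂ) := by
    rw [hderiv]; push_cast; ring
  have hpv : ∀ i, ((![p, q] : Fin 2 → ℕ) i).Prime := fun i => by fin_cases i <;> assumption
  have hov : ∀ i, Odd ((![p, q] : Fin 2 → ℕ) i) := fun i => by
    fin_cases i
    · exact hp.odd_of_ne_two (fun h => by omega)
    · exact hq.odd_of_ne_two (fun h => by omega)
  have hiv : Function.Injective (![p, q] : Fin 2 → ℕ) := by
    intro i j h; fin_cases i <;> fin_cases j <;> simp_all [hne.symm]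
  have hnv : ∏ i, (![p, q] : Fin 2 → ℕ) i = p * q := by simp [Fin.prod_univ_two]
  have he : twoExponent (p * q) = 1 := by
    rw [← hnv, twoExponent_prod_eq _ hpv hov hiv]; norm_num
  -- GZK: rank `1`; kernel Selmer count `8`; hence `Ш[2^∞] = 0`
  obtain ⟨hrank, -⟩ := hGZK (congruentNumberCurve (p * q)) (le_of_eq hr1)
  rw [hr1] at hrank
  have hsel := card_selmerGroup_two_eq_eight_of_isCor515Family hN
  have hbot := primaryComponent_sha_two_eq_bot_of_card_selmerGroup_eq_eight
    (Nat.mul_ne_zero hp.ne_zero hq.ne_zero) hrank hsel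
  refine ⟨hr1, hrank, hbot, ?_⟩
  rw [bsdp_two_iff_of_LDerivOverOmegaReg_of_sha_two_eq_bot_of_torsionOrder_eq_four
    (congruentNumberCurve (p * q)) hGZK hr1 hx hbot (torsionOrder_congruentNumberCurve hsq),
    padicValRat_two_zpow_mul_sq hLodd, he, tamagawaProduct_congruentNumberCurve_prod _ hpv hov hiv hnv,
    padicValNat.prime_pow]
  norm_num

/-- **`BSD(E_{pq}, 2)` for ALL primes `p ≡ 3`, `q ≡ 7 (mod 8)`, ON KERNEL DESCENT** (`∀`-form), modulo
`hTYZ`, `hGZK` only. [cite: TianYuanZhang2017, Thm. 1.2, Thm. 3.5 and §1 (1.1)]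
[cite: Miller2011LMS, Def. 1.1 (arXiv:1010.2431 p. 3)] -/
theorem forall_bsdp_two_congruentNumberCurve_three_seven_descent (hTYZ : tyz_genusPointData)
    (hGZK : rank_eq_analyticRank_of_analyticRank_le_one) :
    ∀ p q : ℕ, p.Prime → q.Prime → p % 8 = 3 → q % 8 = 7 → BSDp (congruentNumberCurve (p * q)) 2 :=
  fun _ _ hp hq hp3 hq7 =>
    (rankOne_sha_bsdp_two_congruentNumberCurve_three_seven_descent hTYZ hGZK hp hq hp3 hq7).2.2.2

end Families


/-! ## §2 Tian's 2014 families (classes `7` and `6`), uniformly in `k`, on kernel descent -/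

section TianFamilies

variable {k : ℕ} (p : Fin (k + 1) → ℕ)

/-- **TIAN'S CLASS-`7` FAMILY ON KERNEL DESCENT.** For `n = p₀p₁⋯p_k` with distinct primes `p₀ ≡ 7`,
`pᵢ ≡ 1 (mod 8)` (`i ≥ 1`) and odd Legendre graph (`hG`: the kernel of Monsky's block `A` is `{0, 𝟙}`,
Tian's condition (1.1) via Lemma 5.1): `ord_{s=1} L(E_n, s) = 1`, rank `1`, `Ш(E_n)[2^∞] = 0`, `BSD(E_n, 2)`
— modulo `h12` (TYZ Thm 1.2 AS PRINTED) and `hGZK` ONLY. Tree theorems used: `ρ(n) = 0`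
(`rhoIndex_eq_one_caseSeven`), `Σ₁(n)` odd (`odd_genusSum₁_caseSeven` on Rédei–Reichardt `_holds`),
Monsky kernel count `2` (`card_ker_monskyTable_caseSeven` — Tian's Lemma 5.3 / (5.1) through Monsky's matrix)
and Monsky's formula with equality. [cite: Tian2014, Thm. 1.3, Lemma 5.1, Lemma 5.3 (arXiv pp. 2, 28–29)]
[cite: TianYuanZhang2017, Thm. 1.2 and §1 (1.1)] [cite: HeathBrown1994SelmerCongruentII, Appendix (Monsky), typescript p. 39 L10–L33]
[cite: Miller2011LMS, Def. 1.1 (arXiv:1010.2431 p. 3)] -/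
theorem rankOne_sha_bsdp_two_congruentNumberCurve_caseSeven_descent (h12 : thm12_parity_of_scriptL')
    (hGZK : rank_eq_analyticRank_of_analyticRank_le_one)
    (hp : ∀ i, (p i).Prime) (hinj : Function.Injective p) (h7 : p 0 % 8 = 7)
    (h1 : ∀ i, i ≠ 0 → p i % 8 = 1) (hG : ∀ v, legendreMatrix p *ᵥ v = 0 → v = 0 ∨ v = fun _ => 1)
    {n : ℕ} (hn : ∏ i, p i = n) :
    haveI := isElliptic_congruentNumberCurve (hn ▸ (squarefree_prod_of_injective p hp hinj).ne_zero)
    (congruentNumberCurve n).analyticRank = 1 ∧ (congruentNumberCurve n).mordellWeilRank = 1 ∧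
      AddCommGroup.primaryComponent (congruentNumberCurve n).sha 2 = ⊥ ∧
      BSDp (congruentNumberCurve n) 2 := by
  haveI : Fact (Nat.Prime 2) := ⟨Nat.prime_two⟩
  obtain ⟨hr1, hrank, hbot, hiff⟩ := bsdp_two_congruentNumberCurve_iff_of_genus' p h12 hGZK
    monsky_card_selmerGroup_two_odd_holds hp (odd_of_caseSeven p h7 h1) hinj hn
    (Or.inr (hn ▸ prod_mod_eight_caseSeven p h7 h1))
    (fun i j => addLegendreSym (p j) (p i)) (fun i => addLegendreSym 2 (p i))
    (fun i => addLegendreSym (-2) (p i)) (fun _ _ => rfl) (fun _ => rfl) (fun _ => rfl)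
    (card_ker_monskyTable_caseSeven p h7 h1 hG) (rhoIndex_eq_one_caseSeven p hp hinj h7 h1 hG hn)
    (Or.inl (odd_genusSum₁_caseSeven p redeiReichardt_fourTwoCard_classGroup_holds hp hinj h7 h1 hG hn))
    (torsionOrder_congruentNumberCurve (hn ▸ squarefree_prod_of_injective p hp hinj))
  refine ⟨hr1, hrank, hbot, hiff.mpr ?_⟩
  rw [tamagawaProduct_congruentNumberCurve_prod p hp (odd_of_caseSeven p h7 h1) hinj hn, padicValNat.prime_pow]

/-- **`BSD(E_n, 2)` on Tian's class-`7` family, quantified, ON KERNEL DESCENT** — modulo `h12`, `hGZK` only;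
nothing per-curve displayed (twin of `forall_bsdp_two_congruentNumberCurve_caseSeven'`, which displays
`h13`, `hR`). [cite: Tian2014, Thm. 1.3 with Lemma 5.1] [cite: TianYuanZhang2017, Thm. 1.2]
[cite: Miller2011LMS, Def. 1.1 (arXiv:1010.2431 p. 3)] -/
theorem forall_bsdp_two_congruentNumberCurve_caseSeven_descent (h12 : thm12_parity_of_scriptL')
    (hGZK : rank_eq_analyticRank_of_analyticRank_le_one) :
    ∀ (k : ℕ) (p : Fin (k + 1) → ℕ), (∀ i, (p i).Prime) → Function.Injective p → p 0 % 8 = 7 →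
      (∀ i, i ≠ 0 → p i % 8 = 1) → (∀ v, legendreMatrix p *ᵥ v = 0 → v = 0 ∨ v = fun _ => 1) →
      BSDp (congruentNumberCurve (∏ i, p i)) 2 :=
  fun _ p hp hinj h7 h1 hG =>
    bsdp_two_congruentNumberCurve_caseSeven' p h12 redeiReichardt_fourTwoCard_classGroup_holds hGZK
      monsky_card_selmerGroup_two_odd_holds hp hinj h7 h1 hG rfl

/-- **TIAN'S CLASS-`6` FAMILY ON KERNEL DESCENT.** For `n = p₀p₁⋯p_k` with distinct primes `p₀ ≡ 3 (mod 4)`,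
`pᵢ ≡ 1 (mod 8)` (`i ≥ 1`) and odd Legendre graph (`hG`): for `E_{2n}` (`2n ≡ 6 (mod 8)`),
`ord_{s=1} L(E_{2n}, s) = 1`, rank `1`, `Ш(E_{2n})[2^∞] = 0`, `BSD(E_{2n}, 2)` — modulo `hTYZ` (TYZ §3, through
the U⁺ composition) and `hGZK` ONLY. Tian 2014 Thm 1.3 (`h13`, previously displayed for rank and `#Ш` odd)
is REPLACED by kernel `2`-descent: Monsky's even kernel count `2` (`card_ker_monskyMatrixEven_caseSix`, the
content of Tian's Lemma 5.3) + Monsky's even formula with equality ⟹ `#Sel₂(E_{2n}) = 8` ⟹ with rank `1`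
(GZK) `Ш[2^∞] = 0`; `Σ₂′(2n)` odd is `odd_genusSum₂'_two_mul_caseSix` on Rédei–Reichardt `_holds`.
[cite: Tian2014, Thm. 1.3, Lemma 5.1, Lemma 5.3, Thm. 5.2 (arXiv p. 2 L5–L15; pp. 28–29)]
[cite: TianYuanZhang2017, Thm. 1.2, Thm. 3.5 and §1 (1.1)]
[cite: HeathBrown1994SelmerCongruentII, Appendix (Monsky), typescript p. 41 L20–L36]
[cite: Miller2011LMS, Def. 1.1 (arXiv:1010.2431 p. 3)] -/
theorem rankOne_sha_bsdp_two_congruentNumberCurve_two_mul_caseSix_descent (hTYZ : tyz_genusPointData)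
    (hGZK : rank_eq_analyticRank_of_analyticRank_le_one)
    (hp : ∀ i, (p i).Prime) (hinj : Function.Injective p) (h3 : p 0 % 4 = 3)
    (h1 : ∀ i, i ≠ 0 → p i % 8 = 1) (hG : ∀ v, legendreMatrix p *ᵥ v = 0 → v = 0 ∨ v = fun _ => 1)
    {n : ℕ} (hn : ∏ i, p i = n) :
    (congruentNumberCurve (2 * n)).analyticRank = 1 ∧ (congruentNumberCurve (2 * n)).mordellWeilRank = 1 ∧
      AddCommGroup.primaryComponent (congruentNumberCurve (2 * n)).sha 2 = ⊥ ∧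
      BSDp (congruentNumberCurve (2 * n)) 2 :=
  rankOne_sha_bsdp_two_congruentNumberCurve_of_uPlus_six p (uPlus_of_genusPointData hTYZ hGZK) hGZK
    monsky_card_selmerGroup_two_even_holds hp (odd_of_caseSix p h3 h1) hinj
    (show 2 * ∏ i, p i = 2 * n by rw [hn]) (by rw [← hn]; exact two_mul_prod_mod_eight_caseSix p h3 h1)
    (fun i j => addLegendreSym (p j) (p i)) (fun i => addLegendreSym 2 (p i))
    (fun i => addLegendreSym (-1) (p i)) (fun _ _ => rfl) (fun _ => rfl) (fun _ => rfl)
    (card_ker_monskyMatrixEven_caseSix p h3 h1 hG)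
    (odd_genusSum₂'_two_mul_caseSix p redeiReichardt_fourTwoCard_classGroup_holds hp hinj h3 h1 hG hn)

/-- **`BSD(E_{2n}, 2)` on Tian's class-`6` family, quantified, ON KERNEL DESCENT** — modulo `hTYZ`, `hGZK`
only; nothing per-curve displayed (twin of `forall_bsdp_two_congruentNumberCurve_two_mul_caseSix_of_genusPointData`,
which displays `h13`, `hR`). [cite: Tian2014, Thm. 1.3 and Thm. 5.2 (arXiv p. 2 L5–L15; p. 28 L40–L43)]
[cite: TianYuanZhang2017, Thm. 1.2 and Thm. 3.5] [cite: Miller2011LMS, Def. 1.1 (arXiv:1010.2431 p. 3)] -/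
theorem forall_bsdp_two_congruentNumberCurve_two_mul_caseSix_descent (hTYZ : tyz_genusPointData)
    (hGZK : rank_eq_analyticRank_of_analyticRank_le_one) :
    ∀ (k : ℕ) (p : Fin (k + 1) → ℕ), (∀ i, (p i).Prime) → Function.Injective p → p 0 % 4 = 3 →
      (∀ i, i ≠ 0 → p i % 8 = 1) → (∀ v, legendreMatrix p *ᵥ v = 0 → v = 0 ∨ v = fun _ => 1) →
      BSDp (congruentNumberCurve (2 * ∏ i, p i)) 2 :=
  fun _ p hp hinj h3 h1 hG =>
    (rankOne_sha_bsdp_two_congruentNumberCurve_two_mul_caseSix_descent p hTYZ hGZK hp hinj h3 h1 hG rfl).2.2.2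

end TianFamilies

/-! ## §3 (APPENDED) The two-prime slice `p₁·q₇`, `(p/q) = −1`, of Tian's class-`7` family, on kernel descent -/

section OneSeven

/-- **`BSD(E_{pq}, 2)` for ALL primes `p ≡ 1`, `q ≡ 7 (mod 8)` with `(p/q) = −1`, ON KERNEL DESCENT** — the
`k = 1` slice of Tian's class-`7` family (odd graph ⟺ `(p/q) = −1`, `oddGraph_one_seven`), modulo `h12` (TYZ
Thm 1.2 AS PRINTED) and `hGZK` ONLY (twin of `forall_bsdp_two_congruentNumberCurve_one_seven'`, which displays
Tian 2014 Thm 1.3 and Rédei–Reichardt). [cite: Tian2014, Thm. 1.3 with Lemma 5.1] [cite: TianYuanZhang2017, Thm. 1.2]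
[cite: Monsky1990MockHeegner, Cor. 5.15 (3) (p. 66)] [cite: Miller2011LMS, Def. 1.1 (arXiv:1010.2431 p. 3)] -/
theorem forall_bsdp_two_congruentNumberCurve_one_seven_descent (h12 : thm12_parity_of_scriptL')
    (hGZK : rank_eq_analyticRank_of_analyticRank_le_one) :
    ∀ p q : ℕ, p.Prime → q.Prime → p % 8 = 1 → q % 8 = 7 → jacobiSym p q = -1 →
      BSDp (congruentNumberCurve (p * q)) 2 := by
  intro p q hp hq h1 h7 hJ
  have hne : q ≠ p := fun h => by omega
  have hinj : Function.Injective (![q, p] : Fin 2 → ℕ) := by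
    intro i j h
    fin_cases i <;> fin_cases j <;> simp_all [hne.symm]
  have h := forall_bsdp_two_congruentNumberCurve_caseSeven_descent h12 hGZK 1 ![q, p]
    (fun i => by fin_cases i <;> assumption) hinj h7 (fun i hi => by fin_cases i <;> simp_all)
    (oddGraph_one_seven hq h1 h7 hJ)
  simpa [Fin.prod_univ_two, mul_comm] using h

end OneSeven


end Summit.BirchSwinnertonDyer.Rank1Residual.P2

end
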